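import Literature.MathematicalPhysics.QuantumFieldTheory.Balaban1983to89.T4TwoRunRateAssembly
import Literature.MathematicalPhysics.QuantumFieldTheory.Balaban1983to89.T4MatchingClosureFed

/-!
# `Balaban1983to89.T4MatchingClosureTwoRun` — BY-NAME SEAM (β): the age-graded two-run budget of
`T4TwoRunRateAssembly` at every step of the log window IS a `T4MatchingClosureFed.StepBudget` (cell `pub-balaban`,
SURGE NODE PROVER #02 lineage = node-U5 closure / assembler; T4-DAG v14 rows T4-U5.E-c-HLOC° (producer: unit pv05,
`T4TwoRunRateAssembly` v1 p183826) / T4-U5.E-CLOSE*-FED (consumer: unit pv02, `T4MatchingClosureFed` v1 p183279); journal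
self-row T4-U5.E-CLOSE*-TWORUN; record `t4/T4-EST-U5.md` §0 (n)/(p); imports those two modules ONLY, modifies nothing)

HONEST FRAMING (cell `pub-balaban`, T4-DAG PAGE 1).  The cell's T4 target is the existence AND uniqueness of the
continuum limit of Bałaban's unit-scale averaged loop expectations on a finite torus — strictly beyond ultraviolet
stability ([Balaban1988Convergent] Cor. 3 p. 264; [Balaban1989LargeFieldII] Thm 1 p. 355); it is NOT infinite volume, NOT
a mass gap, NOT the Clay problem.  This module is KERNEL BOOKKEEPING ONLY (0 estimates): it checks, letter for letter, that
the conclusion of the per-step PRODUCER — unit pv05's `T4TwoRunRateAssembly.leafSum_remnant_radius_le_young_add_old` (the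
remnant-leaf radii of a nested term have leaf sum `≤ A e^{b+τc₁}·K₀·(r·#Q_y + 2σ₀·#Q_o)`) — taken at EVERY step `j` of the
window `[jlog_C K, K]` with STEP-UNIFORM constants `A, R, r₁, s, κ₀, K₀, c₁, b, τ, ν`, the young rate `r := r_j`, the banked
size `σ₀ := ρ^{A(K)}` (`A(K) = T4RemnantBooking.ageCut C′ K`) and step-`j` catalogues / activities / anchoring sets, is the
`step` clause of the CONSUMER's hypothesis shape `T4MatchingClosureFed.StepBudget` with amplitude `E := A·e^{b+τc₁}·K₀`,
`rad j :=` the step-`j` remnant leaf sum, `Qy j := #Q_y(j)`, `Qo j := #Q_o(j)` (§1, `stepBudget_of_twoRun`); hence one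
term's remnant radius, if dominated by the window sum of its step leaf sums, obeys the two remnant rates of
`T4MatchingClosureRem.hybridNE7_closure_remnantW` with `C_y = E·C_r`, `remOld = (fun _ n ↦ 2Eρⁿ)` (§2, `StepBudget.sum_le`
by name), and the existential per-term feed `hsteps` of `T4MatchingClosureFed.remnant_of_steps` /
`hybridNE7_closure_fed_steps` is inhabited from two-run data (§2).  §0 is the count producer `#Q ≤ vol·Λ^{K−j}` from a
containing cube family (one line), §3 the leaf-sum bookkeeping `Σ_j leafSum_j = leafSum (Σ_j ·)` that turns a TOTAL remnant
radius over the union of the step leaf sets into the window-sum binder of §2.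

ABSOLUTE RULE.  NOTHING of [Balaban 1983–89] is quoted as authority or asserted here; no display is transcribed; no
programme-internal claim is cited.  EVERY analytic input — the young two-run RATE `r_j ≤ C_r·θ^j·θ^{−W(K)}` (cell nodes
NE-R1 two-run half / NE2⁺-LF / U5a, NOT PRINTED), the old one-run SIZE `σ₀ = ρ^{A(K)}` (NE7b-rem, NOT PRINTED), (1.26)_rel,
the relative volume bound, footprint locality, the KP smallness, the cube counts, the domination of a term's remnant radius
by its step leaf sums — is a BINDER, exactly as in the two imported modules.  `StepBudget` is INSTANTIATED here only from
those abstract binders (abstract types `Dom`, `Cube`, abstract activities `wA wB : ℕ → Dom → ℂ`), never for Bałaban's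
objects.  Everything below is [folklore] finite real bookkeeping.  For CONTEXT only (format of the binders, all quoted and
cross-read in the imported modules' headers): [Balaban1989LargeFieldII] T. Bałaban, *Large field renormalization. II*,
Commun. Math. Phys. 122 (1989) 355–392, pp. 389–390: (1.97) at the foot of p. 389, (1.98)–(1.100) on p. 390 (one-run,
AGE-FREE activity bounds — LOCATION of the format, not of the two-run rate; text-layer locator checked gen 12).

DICTIONARY.  `j` = the step (scale) inside the window `Icc (jlogOf C K) K` of the cutoff `K`; `Cat j ⊇ Disc j` = the
step-`j` catalogue of polymers of (1.90) and its DISCREPANT sub-catalogue (the two runs agree off `Disc j`); `cubes j`,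
`out j`, `reach j`, `d j` = footprints, outside cubes, reach and `d_{k,∪Y}` at step `j`; `wA j`, `wB j` = the two runs'
activities at step `j` on the common background; `Young j` = «every large-field component hosted by `Z` is young at the
cut `A(K)`»; `Qy j`, `Qo j` = anchoring outside cubes of the young / old-born discrepant polymers at step `j`; `t` = the
term's nested ledger (`T4NestedLevels.Ledger`), `rem j` = its step-`j` remnant leaves, `dom` = their localization domains;
`ry j` = the young two-run rate at step `j`; window constants `C, C′, θ, ρ, C_r, vol, Λ, W, K` as in `T4MatchingClosureFed`.

CONTENTS.  §0 `card_le_of_subset_card_le`.  §1 `stepBudget_of_twoRun` (THE SEAM).  §2 `remnant_le_of_twoRun` (one term: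
`RrRem ≤ vol·((E·C_r)·remnantYoungW θ Λ C W K) + vol·remnantOld (2Eρ^·) Λ C C′ K`), `steps_feed_of_twoRun` (the
existential feed of `T4MatchingClosureFed.remnant_of_steps`).  §3 `Ledger.leafSum_zero_fun`, `Ledger.leafSum_finset_sum`,
`leafSum_indicator_biUnion_le` (total remnant radius over `⋃_j rem j` ≤ window sum of the step leaf sums, for a
non-negative leaf quantity — no disjointness needed).  §4 sanity `example` (the §1 binders are jointly satisfiable: the
empty catalogue at every step).

Value = kernel certificate that producer and consumer shapes MATCH by name (one seam of the node-U5 two-run matching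
design closed at the binder level), NOT an estimate, NOT summit progress.
-/

open Finset

namespace Literature.MathematicalPhysics.QuantumFieldTheory.Balaban1983to89.T4MatchingClosureTwoRun

open Literature.Probability.LatticeModels
open Literature.MathematicalPhysics.QuantumFieldTheory.Balaban1983to89.B13FamilySum
open Literature.MathematicalPhysics.QuantumFieldTheory.Balaban1983to89.B16Exp198
open Literature.MathematicalPhysics.QuantumFieldTheory.Balaban1983to89.B16Exp198TwoRun
open Literature.MathematicalPhysics.QuantumFieldTheory.Balaban1983to89.T4NestedLevels
open Literature.MathematicalPhysics.QuantumFieldTheory.Balaban1983to89.T4RemnantBooking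
open Literature.MathematicalPhysics.QuantumFieldTheory.Balaban1983to89.T4GoodClassBudget
open Literature.MathematicalPhysics.QuantumFieldTheory.Balaban1983to89.T4MatchingClosureRem
open Literature.MathematicalPhysics.QuantumFieldTheory.Balaban1983to89.T4MatchingClosureFed
open Literature.MathematicalPhysics.QuantumFieldTheory.Balaban1983to89.T4TwoRunRateAssembly

variable {Dom Cube : Type*} [DecidableEq Dom] [DecidableEq Cube]
variable (ι : Dom → Dom → Prop) [DecidableRel ι]

/-! ## §0 The count producer -/

omit [DecidableEq Cube] in
/-- **COUNT PRODUCER** (the consumer's `young_count` / `old_count` clauses): anchoring cubes drawn from a step-`j` cube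
family of at most `vol·Λ^{K−j}` members number at most `vol·Λ^{K−j}`. [folklore] -/
theorem card_le_of_subset_card_le {Q U : Finset Cube} {v : ℝ} (hQU : Q ⊆ U) (hU : (U.card : ℝ) ≤ v) :
    (Q.card : ℝ) ≤ v :=
  (Nat.cast_le.mpr (Finset.card_le_card hQU)).trans hU

/-! ## §1 THE SEAM: the per-step two-run budget at every step of the window is a `StepBudget` -/

/-- **SEAM (β): `T4TwoRunRateAssembly.leafSum_remnant_radius_le_young_add_old` AT EVERY STEP OF THE WINDOW IS A
`T4MatchingClosureFed.StepBudget`.**  Step-indexed two-run data (catalogues `Cat j ⊇ Disc j`, footprints, `d j`, activities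
`wA j`, `wB j`, the age predicate `Young j`, anchoring sets `Qy j`, `Qo j`, remnant leaves `rem j` of ONE nested ledger `t`)
with STEP-UNIFORM constants, the young rate `ry j` with `0 ≤ ry j ≤ C_r·θ^j·θ^{−W(K)}`, the banked size `ρ^{A(K)}` on the
old-born discrepant polymers of BOTH runs, and cube counts `#Q_y(j), #Q_o(j) ≤ vol·Λ^{K−j}` give
`StepBudget C C′ θ ρ (A·e^{b+τc₁}·K₀) C_r vol Λ W K rad ry (#Q_y) (#Q_o)` with
`rad j = t.leafSum (i ↦ if i ∈ rem j then ‖𝐑′_A,j(dom i) − 𝐑′_B,j(dom i)‖ else 0)` — the `step` clause is pv05's theorem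
verbatim (`E := A·e^{b+τc₁}·K₀`, `σ₀ := ρ^{ageCut C′ K}`, `r := ry j`). Binders only; nothing asserted. [folklore] -/
theorem stepBudget_of_twoRun [Fintype Dom] [Std.Refl ι] [Std.Symm ι]
    {C C' θ ρ Cr vol Λ : ℝ} {W : ℕ → ℕ} {K : ℕ} {ry : ℕ → ℝ}
    (hry : ∀ j ∈ Icc (jlogOf C K) K, 0 ≤ ry j ∧ ry j ≤ Cr * θ ^ j * θ⁻¹ ^ W K)
    {Cat Disc : ℕ → Finset Dom} (hDisc : ∀ j, Disc j ⊆ Cat j)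
    {cubes out reach : ℕ → Dom → Finset Cube} {d : ℕ → Dom → ℝ} {wA wB : ℕ → Dom → ℂ}
    {A R r₁ s κ₀ K₀ c₁ b τ ν : ℝ}
    (hloc : ∀ j Z, ∀ Z' ∈ Cat j, ι Z' Z → ∃ q ∈ reach j Z, q ∈ out j Z')
    (hreach : ∀ j Z, ((reach j Z).card : ℝ) ≤ ν * (out j Z).card)
    (hd : ∀ j Z, 0 ≤ d j Z) (hA : 0 ≤ A) (hK₀ : 0 ≤ K₀) (hτ : 0 ≤ τ) (hρ : 0 ≤ ρ)
    (hr₁ : 0 ≤ r₁) (hs : 0 ≤ s) (hb : 0 ≤ b)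
    (hwAΛ : ∀ j Z, Z ∉ Cat j → wA j Z = 0) (hwBΛ : ∀ j Z, Z ∉ Cat j → wB j Z = 0)
    (hwA : ∀ j Z, ‖wA j Z‖ ≤ A * Real.exp (-(R * d j Z)))
    (hwB : ∀ j Z, ‖wB j Z‖ ≤ A * Real.exp (-(R * d j Z)))
    (hzero : ∀ j, ∀ Z ∈ Cat j, Z ∉ Disc j → wA j Z = wB j Z)
    (Young : ℕ → Dom → Prop) [∀ j, DecidablePred (Young j)]
    (hrate : ∀ j ∈ Icc (jlogOf C K) K, ∀ Z ∈ Disc j, Young j Z →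
      ‖wA j Z - wB j Z‖ ≤ ry j * (A * Real.exp (-(R * d j Z))))
    (hsizeA : ∀ j ∈ Icc (jlogOf C K) K, ∀ Z ∈ Disc j, ¬Young j Z →
      ‖wA j Z‖ ≤ ρ ^ ageCut C' K * (A * Real.exp (-(R * d j Z))))
    (hsizeB : ∀ j ∈ Icc (jlogOf C K) K, ∀ Z ∈ Disc j, ¬Young j Z →
      ‖wB j Z‖ ≤ ρ ^ ageCut C' K * (A * Real.exp (-(R * d j Z))))
    (h126 : ∀ j, Ineq126 (Cat j) (out j) (d j) κ₀ K₀) (hvol : ∀ j, VolBound (Cat j) (out j) (d j) c₁)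
    (hrate' : κ₀ + (r₁ + s) + τ * c₁ ≤ R) (hsmall : A * Real.exp (b + τ * c₁) * K₀ * ν ≤ τ)
    {Qy Qo : ℕ → Finset Cube}
    (hQy : ∀ j ∈ Icc (jlogOf C K) K, ∀ Z ∈ Disc j, Young j Z → ∃ q ∈ Qy j, q ∈ out j Z)
    (hQo : ∀ j ∈ Icc (jlogOf C K) K, ∀ Z ∈ Disc j, ¬Young j Z → ∃ q ∈ Qo j, q ∈ out j Z)
    (hQyc : ∀ j ∈ Icc (jlogOf C K) K, ((Qy j).card : ℝ) ≤ vol * Λ ^ (K - j))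
    (hQoc : ∀ j ∈ Icc (jlogOf C K) K, ((Qo j).card : ℝ) ≤ vol * Λ ^ (K - j))
    {ιL O : Type*} [DecidableEq ιL] {t : Ledger ιL O} (hnd : t.leaves.Nodup) (rem : ℕ → Finset ιL)
    {dom : ιL → Finset Cube} (hinj : ∀ j, Set.InjOn dom ↑(rem j)) :
    StepBudget C C' θ ρ (A * Real.exp (b + τ * c₁) * K₀) Cr vol Λ W K
      (fun j => t.leafSum fun i => if i ∈ rem j then
        ‖locR ι (Cat j) (cubes j) (wA j) (dom i) - locR ι (Cat j) (cubes j) (wB j) (dom i)‖ else 0)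
      ry (fun j => ((Qy j).card : ℝ)) (fun j => ((Qo j).card : ℝ)) where
  rate := hry
  young_count j hj := ⟨Nat.cast_nonneg _, hQyc j hj⟩
  old_count := hQoc
  step j hj :=
    leafSum_remnant_radius_le_young_add_old ι (hDisc j) (cubes := cubes j) (hloc j) (hreach j) (hd j) hA hK₀ hτ
      (hry j hj).1 (pow_nonneg hρ _) hr₁ hs hb (hwAΛ j) (hwBΛ j) (hwA j) (hwB j) (hzero j) (Young j) (hrate j hj)
      (hsizeA j hj) (hsizeB j hj) (h126 j) (hvol j) hrate' hsmall (hQy j hj) (hQo j hj) hnd (rem j) (hinj j)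

/-! ## §2 One term: the remnant radius from two-run data obeys the two remnant rates; the existential feed -/

/-- **ONE TERM, BY NAME**: under the binders of `stepBudget_of_twoRun`, a remnant radius `RrRem` dominated by the window
sum of the step leaf sums obeys `RrRem ≤ vol·((E·C_r)·remnantYoungW θ Λ C W K) + vol·remnantOld (fun _ n ↦ 2Eρⁿ) Λ C C′ K`,
`E = A·e^{b+τc₁}·K₀` — `T4MatchingClosureFed.StepBudget.sum_le` ∘ §1: exactly the remnant clause `hrem` of
`T4MatchingClosureFed.RemnantSplitBudget.reindexed` for that term. [folklore] -/
theorem remnant_le_of_twoRun [Fintype Dom] [Std.Refl ι] [Std.Symm ι]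
    {C C' θ ρ Cr vol Λ : ℝ} {W : ℕ → ℕ} {K : ℕ} {ry : ℕ → ℝ}
    (hry : ∀ j ∈ Icc (jlogOf C K) K, 0 ≤ ry j ∧ ry j ≤ Cr * θ ^ j * θ⁻¹ ^ W K)
    {Cat Disc : ℕ → Finset Dom} (hDisc : ∀ j, Disc j ⊆ Cat j)
    {cubes out reach : ℕ → Dom → Finset Cube} {d : ℕ → Dom → ℝ} {wA wB : ℕ → Dom → ℂ}
    {A R r₁ s κ₀ K₀ c₁ b τ ν : ℝ}
    (hloc : ∀ j Z, ∀ Z' ∈ Cat j, ι Z' Z → ∃ q ∈ reach j Z, q ∈ out j Z')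
    (hreach : ∀ j Z, ((reach j Z).card : ℝ) ≤ ν * (out j Z).card)
    (hd : ∀ j Z, 0 ≤ d j Z) (hA : 0 ≤ A) (hK₀ : 0 ≤ K₀) (hτ : 0 ≤ τ) (hρ : 0 ≤ ρ)
    (hr₁ : 0 ≤ r₁) (hs : 0 ≤ s) (hb : 0 ≤ b)
    (hwAΛ : ∀ j Z, Z ∉ Cat j → wA j Z = 0) (hwBΛ : ∀ j Z, Z ∉ Cat j → wB j Z = 0)
    (hwA : ∀ j Z, ‖wA j Z‖ ≤ A * Real.exp (-(R * d j Z)))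
    (hwB : ∀ j Z, ‖wB j Z‖ ≤ A * Real.exp (-(R * d j Z)))
    (hzero : ∀ j, ∀ Z ∈ Cat j, Z ∉ Disc j → wA j Z = wB j Z)
    (Young : ℕ → Dom → Prop) [∀ j, DecidablePred (Young j)]
    (hrate : ∀ j ∈ Icc (jlogOf C K) K, ∀ Z ∈ Disc j, Young j Z →
      ‖wA j Z - wB j Z‖ ≤ ry j * (A * Real.exp (-(R * d j Z))))
    (hsizeA : ∀ j ∈ Icc (jlogOf C K) K, ∀ Z ∈ Disc j, ¬Young j Z →
      ‖wA j Z‖ ≤ ρ ^ ageCut C' K * (A * Real.exp (-(R * d j Z))))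
    (hsizeB : ∀ j ∈ Icc (jlogOf C K) K, ∀ Z ∈ Disc j, ¬Young j Z →
      ‖wB j Z‖ ≤ ρ ^ ageCut C' K * (A * Real.exp (-(R * d j Z))))
    (h126 : ∀ j, Ineq126 (Cat j) (out j) (d j) κ₀ K₀) (hvol : ∀ j, VolBound (Cat j) (out j) (d j) c₁)
    (hrate' : κ₀ + (r₁ + s) + τ * c₁ ≤ R) (hsmall : A * Real.exp (b + τ * c₁) * K₀ * ν ≤ τ)
    {Qy Qo : ℕ → Finset Cube}
    (hQy : ∀ j ∈ Icc (jlogOf C K) K, ∀ Z ∈ Disc j, Young j Z → ∃ q ∈ Qy j, q ∈ out j Z)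
    (hQo : ∀ j ∈ Icc (jlogOf C K) K, ∀ Z ∈ Disc j, ¬Young j Z → ∃ q ∈ Qo j, q ∈ out j Z)
    (hQyc : ∀ j ∈ Icc (jlogOf C K) K, ((Qy j).card : ℝ) ≤ vol * Λ ^ (K - j))
    (hQoc : ∀ j ∈ Icc (jlogOf C K) K, ((Qo j).card : ℝ) ≤ vol * Λ ^ (K - j))
    {ιL O : Type*} [DecidableEq ιL] {t : Ledger ιL O} (hnd : t.leaves.Nodup) (rem : ℕ → Finset ιL)
    {dom : ιL → Finset Cube} (hinj : ∀ j, Set.InjOn dom ↑(rem j)) {RrRem : ℝ}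
    (hRem : RrRem ≤ ∑ j ∈ Icc (jlogOf C K) K, t.leafSum fun i => if i ∈ rem j then
      ‖locR ι (Cat j) (cubes j) (wA j) (dom i) - locR ι (Cat j) (cubes j) (wB j) (dom i)‖ else 0) :
    RrRem ≤ vol * (((A * Real.exp (b + τ * c₁) * K₀) * Cr) * remnantYoungW θ Λ C W K) +
      vol * remnantOld (fun _ n => 2 * (A * Real.exp (b + τ * c₁) * K₀) * ρ ^ n) Λ C C' K :=
  hRem.trans ((stepBudget_of_twoRun ι hry hDisc hloc hreach hd hA hK₀ hτ hρ hr₁ hs hb hwAΛ hwBΛ hwA hwB hzero Young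
    hrate hsizeA hsizeB h126 hvol hrate' hsmall hQy hQo hQyc hQoc hnd rem hinj).sum_le (by positivity) hρ)

/-- **THE EXISTENTIAL FEED** of `T4MatchingClosureFed.remnant_of_steps` / `reindexedBudget_of_steps` /
`hybridNE7_closure_fed_steps` for ONE term: `∃ rad ry Qy Qo, StepBudget … ∧ RrRem ≤ Σ_j rad j`, inhabited by the two-run
data of §1 and the domination binder `hRem`.  The consumer's `hsteps` is this statement for every good term
`τ ∈ T K \ Bad K t`, `|t| ≤ l₀`, with ONE amplitude `E = A·e^{b+τc₁}·K₀` and ONE `C_r` — i.e. STEP-, TERM- and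
CUTOFF-UNIFORM constants `A, b, τ, c₁, K₀, C_r` (binders of the producer side). [folklore] -/
theorem steps_feed_of_twoRun [Fintype Dom] [Std.Refl ι] [Std.Symm ι]
    {C C' θ ρ Cr vol Λ : ℝ} {W : ℕ → ℕ} {K : ℕ} {ry : ℕ → ℝ}
    (hry : ∀ j ∈ Icc (jlogOf C K) K, 0 ≤ ry j ∧ ry j ≤ Cr * θ ^ j * θ⁻¹ ^ W K)
    {Cat Disc : ℕ → Finset Dom} (hDisc : ∀ j, Disc j ⊆ Cat j)
    {cubes out reach : ℕ → Dom → Finset Cube} {d : ℕ → Dom → ℝ} {wA wB : ℕ → Dom → ℂ}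
    {A R r₁ s κ₀ K₀ c₁ b τ ν : ℝ}
    (hloc : ∀ j Z, ∀ Z' ∈ Cat j, ι Z' Z → ∃ q ∈ reach j Z, q ∈ out j Z')
    (hreach : ∀ j Z, ((reach j Z).card : ℝ) ≤ ν * (out j Z).card)
    (hd : ∀ j Z, 0 ≤ d j Z) (hA : 0 ≤ A) (hK₀ : 0 ≤ K₀) (hτ : 0 ≤ τ) (hρ : 0 ≤ ρ)
    (hr₁ : 0 ≤ r₁) (hs : 0 ≤ s) (hb : 0 ≤ b)
    (hwAΛ : ∀ j Z, Z ∉ Cat j → wA j Z = 0) (hwBΛ : ∀ j Z, Z ∉ Cat j → wB j Z = 0)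
    (hwA : ∀ j Z, ‖wA j Z‖ ≤ A * Real.exp (-(R * d j Z)))
    (hwB : ∀ j Z, ‖wB j Z‖ ≤ A * Real.exp (-(R * d j Z)))
    (hzero : ∀ j, ∀ Z ∈ Cat j, Z ∉ Disc j → wA j Z = wB j Z)
    (Young : ℕ → Dom → Prop) [∀ j, DecidablePred (Young j)]
    (hrate : ∀ j ∈ Icc (jlogOf C K) K, ∀ Z ∈ Disc j, Young j Z →
      ‖wA j Z - wB j Z‖ ≤ ry j * (A * Real.exp (-(R * d j Z))))
    (hsizeA : ∀ j ∈ Icc (jlogOf C K) K, ∀ Z ∈ Disc j, ¬Young j Z →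
      ‖wA j Z‖ ≤ ρ ^ ageCut C' K * (A * Real.exp (-(R * d j Z))))
    (hsizeB : ∀ j ∈ Icc (jlogOf C K) K, ∀ Z ∈ Disc j, ¬Young j Z →
      ‖wB j Z‖ ≤ ρ ^ ageCut C' K * (A * Real.exp (-(R * d j Z))))
    (h126 : ∀ j, Ineq126 (Cat j) (out j) (d j) κ₀ K₀) (hvol : ∀ j, VolBound (Cat j) (out j) (d j) c₁)
    (hrate' : κ₀ + (r₁ + s) + τ * c₁ ≤ R) (hsmall : A * Real.exp (b + τ * c₁) * K₀ * ν ≤ τ)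
    {Qy Qo : ℕ → Finset Cube}
    (hQy : ∀ j ∈ Icc (jlogOf C K) K, ∀ Z ∈ Disc j, Young j Z → ∃ q ∈ Qy j, q ∈ out j Z)
    (hQo : ∀ j ∈ Icc (jlogOf C K) K, ∀ Z ∈ Disc j, ¬Young j Z → ∃ q ∈ Qo j, q ∈ out j Z)
    (hQyc : ∀ j ∈ Icc (jlogOf C K) K, ((Qy j).card : ℝ) ≤ vol * Λ ^ (K - j))
    (hQoc : ∀ j ∈ Icc (jlogOf C K) K, ((Qo j).card : ℝ) ≤ vol * Λ ^ (K - j))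
    {ιL O : Type*} [DecidableEq ιL] {t : Ledger ιL O} (hnd : t.leaves.Nodup) (rem : ℕ → Finset ιL)
    {dom : ιL → Finset Cube} (hinj : ∀ j, Set.InjOn dom ↑(rem j)) {RrRem : ℝ}
    (hRem : RrRem ≤ ∑ j ∈ Icc (jlogOf C K) K, t.leafSum fun i => if i ∈ rem j then
      ‖locR ι (Cat j) (cubes j) (wA j) (dom i) - locR ι (Cat j) (cubes j) (wB j) (dom i)‖ else 0) :
    ∃ rad ry' Qy' Qo' : ℕ → ℝ,
      StepBudget C C' θ ρ (A * Real.exp (b + τ * c₁) * K₀) Cr vol Λ W K rad ry' Qy' Qo' ∧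
        RrRem ≤ ∑ j ∈ Icc (jlogOf C K) K, rad j :=
  ⟨_, ry, _, _, stepBudget_of_twoRun ι hry hDisc hloc hreach hd hA hK₀ hτ hρ hr₁ hs hb hwAΛ hwBΛ hwA hwB hzero Young
    hrate hsizeA hsizeB h126 hvol hrate' hsmall hQy hQo hQyc hQoc hnd rem hinj, hRem⟩

/-! ## §3 Leaf-sum bookkeeping: a TOTAL remnant radius over `⋃_j rem j` is at most the window sum of the step leaf sums -/

section LeafSum

variable {ιL O : Type*}

omit [DecidableEq Dom] [DecidableEq Cube] [DecidableRel ι] in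
/-- `leafSum` of the zero leaf quantity vanishes. [folklore] -/
theorem Ledger.leafSum_zero_fun : ∀ t : Ledger ιL O, t.leafSum (fun _ => (0 : ℝ)) = 0
  | .leaf _ => rfl
  | .mul s u => by simp only [Ledger.leafSum, Ledger.leafSum_zero_fun s, Ledger.leafSum_zero_fun u, add_zero]
  | .add s u => by simp only [Ledger.leafSum, Ledger.leafSum_zero_fun s, Ledger.leafSum_zero_fun u, add_zero]
  | .app _ u => by simp only [Ledger.leafSum, Ledger.leafSum_zero_fun u]

omit [DecidableEq Dom] [DecidableEq Cube] [DecidableRel ι] in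
/-- `leafSum` commutes with finite sums of leaf quantities (`T4NestedLevels.Ledger.leafSum_add`, iterated). [folklore] -/
theorem Ledger.leafSum_finset_sum {β : Type*} [DecidableEq β] (S : Finset β) (f : β → ιL → ℝ) (t : Ledger ιL O) :
    t.leafSum (fun i => ∑ b ∈ S, f b i) = ∑ b ∈ S, t.leafSum (f b) := by
  induction S using Finset.induction_on with
  | empty => simpa using Ledger.leafSum_zero_fun t
  | insert a S ha ih =>
    rw [Finset.sum_insert ha, ← ih, ← Ledger.leafSum_add]
    exact congrArg (fun c => t.leafSum c) (funext fun i => Finset.sum_insert ha)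

omit [DecidableEq Dom] [DecidableEq Cube] [DecidableRel ι] in
/-- **TOTAL ≤ WINDOW SUM**: for a non-negative leaf quantity `c` and a leaf set `remAll` covered by the step leaf sets,
`remAll ⊆ ⋃_{j ∈ S} rem j`, one has `t.leafSum (𝟙_{remAll}·c) ≤ Σ_{j ∈ S} t.leafSum (𝟙_{rem j}·c)` — no disjointness of
the `rem j` is needed (overlaps only over-count).  With `S` the log window and `c` the remnant radii this is the binder
`hRem` of §2 from a TOTAL remnant radius `RrRem ≤ t.leafSum (𝟙_{remAll}·c)`. [folklore] -/
theorem leafSum_indicator_biUnion_le [DecidableEq ιL] {β : Type*} [DecidableEq β] (S : Finset β)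
    (rem : β → Finset ιL) {remAll : Finset ιL} (hcover : ∀ i ∈ remAll, ∃ j ∈ S, i ∈ rem j)
    {c : ιL → ℝ} (hc : ∀ i, 0 ≤ c i) (t : Ledger ιL O) :
    t.leafSum (fun i => if i ∈ remAll then c i else 0) ≤
      ∑ j ∈ S, t.leafSum (fun i => if i ∈ rem j then c i else 0) := by
  rw [← Ledger.leafSum_finset_sum]
  refine Ledger.leafSum_mono (fun i => ?_) t
  have h0 : ∀ j ∈ S, (0 : ℝ) ≤ if i ∈ rem j then c i else 0 := fun j _ => by
    split_ifs
    · exact hc i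
    · exact le_rfl
  split_ifs with hi
  · obtain ⟨j, hjS, hij⟩ := hcover i hi
    calc c i = (if i ∈ rem j then c i else 0) := by rw [if_pos hij]
      _ ≤ ∑ j ∈ S, (if i ∈ rem j then c i else 0) := Finset.single_le_sum h0 hjS
  · exact Finset.sum_nonneg h0

end LeafSum

/-! ## §4 Sanity: the §1 binders are jointly satisfiable -/

section Sanity

/-- SANITY (non-vacuity of the hypothesis set of `stepBudget_of_twoRun`): the EMPTY catalogue at every step (no polymers,
`Dom = Cube = Unit`, the total relation, `Cat j = Disc j = ∅`, activities `0`, one-leaf ledger, `rem j = ∅`, `ry = 0`, all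
constants `0` except `c₁ = K₀ = 1`): a `StepBudget` with `rad = 0`. [folklore] -/
example (C C' θ ρ vol Λ : ℝ) (hρ : 0 ≤ ρ) (hvol : 0 ≤ vol) (hΛ : 0 ≤ Λ) (W : ℕ → ℕ) (K : ℕ) :
    StepBudget C C' θ ρ (0 * Real.exp (0 + 0 * 1) * 1) 0 vol Λ W K
      (fun j => (Ledger.leaf () : Ledger Unit Unit).leafSum fun i => if i ∈ (fun _ : ℕ => (∅ : Finset Unit)) j then
        ‖locR (fun _ _ : Unit => True) ((fun _ : ℕ => (∅ : Finset Unit)) j)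
            ((fun _ : ℕ => fun _ : Unit => (∅ : Finset Unit)) j) ((fun _ : ℕ => fun _ : Unit => (0 : ℂ)) j)
            ((fun _ : Unit => (∅ : Finset Unit)) i) -
          locR (fun _ _ : Unit => True) ((fun _ : ℕ => (∅ : Finset Unit)) j)
            ((fun _ : ℕ => fun _ : Unit => (∅ : Finset Unit)) j) ((fun _ : ℕ => fun _ : Unit => (0 : ℂ)) j)
            ((fun _ : Unit => (∅ : Finset Unit)) i)‖ else 0)
      (fun _ => 0) (fun j => (((fun _ : ℕ => (∅ : Finset Unit)) j).card : ℝ))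
      (fun j => (((fun _ : ℕ => (∅ : Finset Unit)) j).card : ℝ)) := by
  haveI : Std.Refl (fun _ _ : Unit => True) := ⟨fun _ => trivial⟩
  haveI : Std.Symm (fun _ _ : Unit => True) := ⟨fun _ _ _ => trivial⟩
  exact stepBudget_of_twoRun (fun _ _ : Unit => True) (C := C) (C' := C') (θ := θ) (ρ := ρ) (Cr := 0) (vol := vol)
    (Λ := Λ) (W := W) (K := K) (ry := fun _ => 0) (fun j _ => ⟨le_rfl, by simp⟩)
    (Cat := fun _ => ∅) (Disc := fun _ => ∅) (fun _ => Finset.Subset.refl _)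
    (cubes := fun _ _ => ∅) (out := fun _ _ => ∅) (reach := fun _ _ => ∅) (d := fun _ _ => 0)
    (wA := fun _ _ => 0) (wB := fun _ _ => 0) (A := 0) (R := 0) (r₁ := 0) (s := 0) (κ₀ := 0) (K₀ := 1) (c₁ := 1)
    (b := 0) (τ := 0) (ν := 0)
    (fun _ _ Z' hZ' _ => by simp at hZ') (fun _ _ => by simp) (fun _ _ => le_rfl) le_rfl
    zero_le_one le_rfl hρ le_rfl le_rfl le_rfl (fun _ _ _ => rfl) (fun _ _ _ => rfl) (fun _ _ => by simp)
    (fun _ _ => by simp) (fun _ Z hZ _ => by simp at hZ) (fun _ _ => False)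
    (fun _ _ Z hZ _ => by simp at hZ) (fun _ _ Z hZ _ => by simp at hZ) (fun _ _ Z hZ _ => by simp at hZ)
    (fun _ c => by simp) (fun _ Y hY => by simp at hY) (by norm_num) (by norm_num) (Qy := fun _ => ∅) (Qo := fun _ => ∅)
    (fun _ _ Z hZ _ => by simp at hZ) (fun _ _ Z hZ _ => by simp at hZ)
    (fun j _ => by simp; positivity) (fun j _ => by simp; positivity) (t := Ledger.leaf ()) (by simp [Ledger.leaves])
    (fun _ => ∅) (dom := fun _ => ∅) (fun _ => by simp)

end Sanity

end Literature.MathematicalPhysics.QuantumFieldTheory.Balaban1983to89.T4MatchingClosureTwoRun
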